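import Literature.NumberTheory.PAdicHodge.AinfRamifiedOmegaPeriod
import Literature.NumberTheory.PAdicHodge.AinfRamifiedOmegaComplete
import Literature.NumberTheory.PAdicHodge.AinfRamifiedComplete
import Literature.NumberTheory.PAdicHodge.BdRPlusLatticeSeparated
import Literature.NumberTheory.EllipticCurves.FormalGroupHasseInvariantProofs
import HarnessLib

/-!
# Fontaine's lattices over the ramified base: `⋂_N (p^N ι_𝒪(A_inf(𝒪)) + Fil^k) = Fil^k`, boundedness `k!·∫_t ω ∈ ι_𝒪(A_inf(𝒪)) + Fil^k`,
# and `ℤ_p`-linearity of bounded additive maps into `B_dR⁺(F)` (proofs only)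

Topic `Literature/NumberTheory/PAdicHodge`. THEOREMS ONLY (no definition, no named fact, no instance, no `sorry`). The ramified twin
(`𝒪 = 𝒪_D = ℤ_p[ϖ]`, `A_inf(𝒪) = 𝔸_inf(F)[ϖ]`, `ι_𝒪 = AinfRam.toBdR`) of `BdRPlusLatticeSeparated` §2–§4, `AinfWeierstrassPeriodsBounded`
and `AinfWeierstrassPeriodsLinear` §1 (case `𝒪 = ℤ_p`), road item (E0′) of the de Rham socket for K★'s additive cells
(memo `Cruxes/StarredOptimalManinUnitFiveSeven/Lines/kato-lever-hDR-R1-models-descent.md` §6, BSD route EdixhovenFibreFiveSeven, crux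
`stmt-BirchSwinnertonDyer-22226`). Inputs: `A_inf(𝒪) ∩ Fil^k = ω^k A_inf(𝒪)` (`AinfRam.omega_pow_dvd_of_toBdR_mem_span_pow`,
file `AinfRamifiedComplete`) and the `p`-adic closedness of `ω^k A_inf(𝒪)` (`AinfRam.omega_pow_dvd_of_forall`, file `AinfRamifiedOmegaComplete`).

* §1 `BdRPlusTop.eq_zero_of_forall_mem_filOne_pow` (`⋂_k Fil^k = 0` on `BdRPlusTop`); **`AinfRam.mem_filOne_pow_of_forall_lattice`**:
  `x ∈ p^N ι_𝒪(A_inf(𝒪)) + Fil^k` for every `N` ⟹ `x ∈ Fil^k`; `AinfRam.eq_zero_of_forall_lattice`, `AinfRam.eq_zero_of_forall_int_mul_lattice`.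
* §2 **`AinfRam.map_smul_eq_of_bounded`**: an additive map `φ : M → B_dR⁺(F)` on a `ℤ_p`-module with `d_k·φ(M) ⊆ ι_𝒪(A_inf(𝒪)) + Fil^k`
  (`d_k ∈ ℤ ∖ 0`) satisfies `φ(a·m) = ι(a)·φ(m)` for `a ∈ ℤ_p` (write `a = r + p^N c`, `r ∈ ℕ`).
* §3 `BdRPlusTop.exists_eq_toBdR_add_of_coeff`: a series `f ∈ F⟦X⟧` with `d·fₙ ∈ ι_𝒪(A_inf(𝒪))` for `n < k`, evaluated at `x = ι_𝒪(a) ∈ Fil¹`,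
  has `d·f(x) ∈ ι_𝒪(A_inf(𝒪)) + Fil^k`.
* §4 denominators of `log_W` for `W` over `𝒪_D`: `(n+1)·log_{n+1} = ωₙ ∈ 𝒪_D`; **`AinfRamTop.omegaPeriod_bounded`**:
  `k!·∫_t ω ∈ ι_𝒪(A_inf(𝒪)) + Fil^k B_dR⁺` uniformly in the `[p]`-compatible sequence `t`.

The η-analogue (`k!·∫_t η`) follows the same way from the η-period over `A_inf(𝒪)` (separate file). BSD / K★ are not proved by any of this.

## References
* J.-M. Fontaine, *Le corps des périodes p-adiques*, Astérisque 223 (1994), Exp. II §1.5.3–1.5.5. [FontaineAsterisque223III]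
* L. Fargues, J.-M. Fontaine, Astérisque 406 (2018), §2.2. [FarguesFontaine2018]
* P. Colmez, *Périodes p-adiques des variétés abéliennes*, Math. Ann. 292 (1992), §2. [Colmez1992PeriodesAbeliennes]
* J. H. Silverman, *The Arithmetic of Elliptic Curves* (2009), IV.1, IV.5.5. [SilvermanAEC2009]
-/

noncomputable section

open Ideal Filter Topology Field WittVector MvPowerSeries ValuativeRel

namespace Literature.NumberTheory.PAdicHodge

open Literature.NumberTheory.GaloisRepresentations
open Literature.NumberTheory.GaloisRepresentations.IsNonarchimedeanLocalField
open Literature.NumberTheory.GaloisRepresentations.LubinTate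

/-! ## §1 The lattices `p^N ι_𝒪(A_inf(𝒪)) + Fil^k` are separated modulo `Fil^k` -/

namespace BdRPlusTop

variable {F : Type} [Field F] [ValuativeRel F] [TopologicalSpace F] [IsNonarchimedeanLocalField F] [CharZero F]
  {p : ℕ} [Fact p.Prime] [Fact (¬ IsUnit (p : integerC F))] [IsAdicComplete (Ideal.span {(p : integerC F)}) (integerC F)]

/-- **`⋂_k Fil^k B_dR⁺ = 0`** on `BdRPlusTop` (`B_dR⁺` is `ξ`-adically separated). [cite: FontaineAsterisque223III, Exp. II §1.5.5] -/
theorem eq_zero_of_forall_mem_filOne_pow {x : BdRPlusTop F p} (h : ∀ k : ℕ, x ∈ ((filOne F p).toIdeal ^ k : Ideal (BdRPlusTop F p))) :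
    x = 0 :=
  eq_zero_of_forall_lattice fun k N => by
    have hk := h k
    rw [show (filOne F p).toIdeal = (WithIdeal.i : Ideal (BdRPlusTop F p)) from rfl, ideal_eq, Ideal.span_singleton_pow,
      Ideal.mem_span_singleton'] at hk
    obtain ⟨w, hw⟩ := hk
    exact ⟨0, w, by rw [mul_zero, map_zero, zero_add, mul_comm, hw]⟩

end BdRPlusTop

namespace AinfRam

variable {F : Type} [Field F] [ValuativeRel F] [TopologicalSpace F] [IsNonarchimedeanLocalField F] [CharZero F]
  {p : ℕ} [Fact p.Prime] [Fact (¬ IsUnit (p : integerC F))] [IsAdicComplete (Ideal.span {(p : integerC F)}) (integerC F)]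
  {hp : valuation F p < 1} (D : EisensteinRoot F p hp) (hF : Function.Surjective (fontaineTheta (integerC F) p))

/-- `ι_𝒪(z · b) = ι(z) · ι_𝒪(b)` for `z ∈ 𝔸_inf(F)` (`ι_𝒪` extends `ι`), read on `BdRPlusTop`. [cite: FontaineAsterisque223III, Exp. II §1.5.3] -/
theorem of_toBdR_algebraMap_mul (z : Ainf (p := p) F) (b : AinfRam D) :
    BdRPlusTop.of F p (toBdR D hF (algebraMap (Ainf (p := p) F) (AinfRam D) z * b)) =
      BdRPlusTop.ofAinf F p z * BdRPlusTop.of F p (toBdR D hF b) := by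
  rw [map_mul, toBdR_algebraMap, map_mul]
  rfl

/-- `ι_𝒪(p^N · b) = p^N · ι_𝒪(b)` on `BdRPlusTop`. [cite: FontaineAsterisque223III, Exp. II §1.5.3] -/
theorem of_toBdR_natCast_pow_mul (N : ℕ) (b : AinfRam D) :
    BdRPlusTop.of F p (toBdR D hF ((p : AinfRam D) ^ N * b)) = (p : BdRPlusTop F p) ^ N * BdRPlusTop.of F p (toBdR D hF b) := by
  rw [map_mul, map_pow, map_natCast, map_mul, map_pow, map_natCast]

/-- **The lattices over the ramified base are separated modulo `Fil^k`**: if `x ∈ p^N ι_𝒪(A_inf(𝒪)) + ξ^k B_dR⁺` for every `N`,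
then `x ∈ ξ^k B_dR⁺`. With `x = ι_𝒪(a₀) + ξ^k w₀` (`N = 0`): `ι_𝒪(a₀ − p^N a_N) ∈ ξ^k B_dR⁺`, so `ω^k ∣ a₀ − p^N a_N`
(`A_inf(𝒪) ∩ Fil^k = ω^k A_inf(𝒪)`) for every `N`, so `ω^k ∣ a₀` (`ω^k A_inf(𝒪)` is `p`-adically closed), and `ι_𝒪(ω) ∈ ξ_dR B_dR⁺`.
[cite: FontaineAsterisque223III, Exp. II §1.5.3] [cite: FarguesFontaine2018, §2.2] -/
theorem mem_filOne_pow_of_forall_lattice {x : BdRPlusTop F p} {k : ℕ}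
    (h : ∀ N : ℕ, ∃ (a : AinfRam D) (w : BdRPlusTop F p),
      x = BdRPlusTop.of F p (toBdR D hF ((p : AinfRam D) ^ N * a)) + BdRPlusTop.of F p xiBdR ^ k * w) :
    x ∈ ((BdRPlusTop.filOne F p).toIdeal ^ k : Ideal (BdRPlusTop F p)) := by
  obtain ⟨a₀, w₀, h₀⟩ := h 0
  rw [pow_zero, one_mul] at h₀
  have ha₀ : omega D ^ k ∣ a₀ := by
    refine omega_pow_dvd_of_forall D hF k fun N => ?_
    obtain ⟨a, w, hN⟩ := h N
    have hdiff : toBdR D hF (a₀ - (p : AinfRam D) ^ N * a) ∈ Ideal.span {(xiBdR : BDeRhamPlus (integerC F) p) ^ k} := by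
      refine Ideal.mem_span_singleton'.2 ⟨(BdRPlusTop.of F p).symm (w - w₀), ?_⟩
      apply (BdRPlusTop.of F p).injective
      have h1 : BdRPlusTop.of F p (toBdR D hF a₀) - BdRPlusTop.of F p (toBdR D hF ((p : AinfRam D) ^ N * a)) =
          BdRPlusTop.of F p xiBdR ^ k * w - BdRPlusTop.of F p xiBdR ^ k * w₀ := by
        linear_combination h₀.symm.trans hN
      rw [map_mul (BdRPlusTop.of F p), RingEquiv.apply_symm_apply, map_pow, map_sub (toBdR D hF),
        map_sub (BdRPlusTop.of F p), h1]
      ring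
    obtain ⟨y, hy⟩ := omega_pow_dvd_of_toBdR_mem_span_pow D hF k hdiff
    exact ⟨y, a, by rw [← hy]; ring⟩
  obtain ⟨y, rfl⟩ := ha₀
  obtain ⟨v, hv⟩ := exists_unit_toBdR_omega_eq D hF
  rw [h₀, map_mul (toBdR D hF), map_pow, hv, mul_pow, map_mul (BdRPlusTop.of F p), map_mul (BdRPlusTop.of F p), map_pow,
    show (BdRPlusTop.filOne F p).toIdeal = (WithIdeal.i : Ideal (BdRPlusTop F p)) from rfl,
    BdRPlusTop.ideal_eq, Ideal.span_singleton_pow]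
  refine Submodule.add_mem _ ?_ (Ideal.mul_mem_right _ _ (Ideal.mem_span_singleton_self _))
  rw [mul_assoc]
  exact Ideal.mul_mem_right _ _ (Ideal.mem_span_singleton_self _)

/-- **Hausdorff**: an element of `BdRPlusTop` lying in every lattice `p^N ι_𝒪(A_inf(𝒪)) + Fil^k` is `0`.
[cite: FontaineAsterisque223III, Exp. II §1.5.5] -/
theorem eq_zero_of_forall_lattice {x : BdRPlusTop F p}
    (h : ∀ k N : ℕ, ∃ (a : AinfRam D) (w : BdRPlusTop F p),
      x = BdRPlusTop.of F p (toBdR D hF ((p : AinfRam D) ^ N * a)) + BdRPlusTop.of F p xiBdR ^ k * w) : x = 0 :=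
  BdRPlusTop.eq_zero_of_forall_mem_filOne_pow fun k => mem_filOne_pow_of_forall_lattice D hF (h k)

omit [CharZero F] in
/-- A nonzero integer is a unit of `B_dR⁺` (a `ℚ`-algebra). [folklore] -/
private theorem isUnit_intCast_bdR {d : ℤ} (hd : d ≠ 0) : IsUnit ((d : BdRPlusTop F p)) := by
  have h1 : IsUnit ((d : ℚ)) := isUnit_iff_ne_zero.2 (Int.cast_ne_zero.2 hd)
  have h2 := (h1.map RatCoeff.of.toRingHom).map (algebraMap RatCoeff (BdRPlusTop F p))
  rwa [map_intCast, map_intCast] at h2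

/-- An element of `B_dR⁺` a nonzero-integer multiple of which (the integer depending on `k`) lies in every lattice
`p^N ι_𝒪(A_inf(𝒪)) + Fil^k` is `0`. [cite: FontaineAsterisque223III, Exp. II §1.5.5] -/
theorem eq_zero_of_forall_int_mul_lattice {x : BdRPlusTop F p}
    (h : ∀ k : ℕ, ∃ d : ℤ, d ≠ 0 ∧ ∀ N : ℕ, ∃ (a : AinfRam D) (w : BdRPlusTop F p),
      (d : BdRPlusTop F p) * x = BdRPlusTop.of F p (toBdR D hF ((p : AinfRam D) ^ N * a)) + BdRPlusTop.of F p xiBdR ^ k * w) :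
    x = 0 := by
  refine BdRPlusTop.eq_zero_of_forall_mem_filOne_pow fun k => ?_
  obtain ⟨d, hd, hN⟩ := h k
  have hx : (d : BdRPlusTop F p) * x ∈ ((BdRPlusTop.filOne F p).toIdeal ^ k : Ideal (BdRPlusTop F p)) :=
    mem_filOne_pow_of_forall_lattice D hF hN
  exact (Ideal.unit_mul_mem_iff_mem _ (isUnit_intCast_bdR hd)).1 hx

/-! ## §2 Bounded additive maps into `B_dR⁺` are `ℤ_p`-linear -/

/-- **Bounded additive maps into `B_dR⁺` are `ℤ_p`-linear** (ramified lattices): if `φ : M →+ B_dR⁺` satisfies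
`d_k·φ(M) ⊆ ι_𝒪(A_inf(𝒪)) + Fil^k` with `d_k ∈ ℤ ∖ 0` for every `k`, then `φ(a·m) = ι(a)·φ(m)` for all `a ∈ ℤ_p`: writing
`a = r + p^N c` (`r ∈ ℕ`, Mathlib `PadicInt.appr`), `φ(a·m) − ι(a)φ(m) = p^N (φ(c·m) − ι(c)φ(m))` lies, after multiplication by `d_k`,
in `p^N ι_𝒪(A_inf(𝒪)) + Fil^k` for every `N`. [cite: FontaineAsterisque223III, Exp. II §1.5.3–1.5.5] [cite: Colmez1992PeriodesAbeliennes, §2] -/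
theorem map_smul_eq_of_bounded {M : Type*} [AddCommGroup M] [Module ℤ_[p] M] (φ : M →+ BdRPlusTop F p)
    (hφ : ∀ k : ℕ, ∃ d : ℤ, d ≠ 0 ∧ ∀ m : M, ∃ (b : AinfRam D) (w : BdRPlusTop F p),
      (d : BdRPlusTop F p) * φ m = BdRPlusTop.of F p (toBdR D hF b) + BdRPlusTop.of F p xiBdR ^ k * w)
    (a : ℤ_[p]) (m : M) : φ (a • m) = BdRPlusTop.ofAinf F p (zpToAinf a) * φ m := by
  rw [← sub_eq_zero]
  refine eq_zero_of_forall_int_mul_lattice D hF fun k => ?_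
  obtain ⟨d, hd, hb⟩ := hφ k
  refine ⟨d, hd, fun N => ?_⟩
  -- `a = r + p^N c` with `r = appr a N ∈ ℕ`
  obtain ⟨c, hc⟩ := Ideal.mem_span_singleton'.1 (PadicInt.appr_spec N a)
  obtain ⟨r, hr⟩ : ∃ r : ℕ, a.appr N = r := ⟨_, rfl⟩
  rw [hr] at hc
  have ha : a = (r : ℤ_[p]) + (p : ℤ_[p]) ^ N * c := by rw [mul_comm, hc]; ring
  have hsmul : a • m = r • m + p ^ N • (c • m) := by
    rw [ha, add_smul, Nat.cast_smul_eq_nsmul, mul_smul, ← Nat.cast_pow, Nat.cast_smul_eq_nsmul]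
  have hι : BdRPlusTop.ofAinf F p (zpToAinf a) =
      (r : BdRPlusTop F p) + (p : BdRPlusTop F p) ^ N * BdRPlusTop.ofAinf F p (zpToAinf c) := by
    rw [ha, map_add, map_mul, map_pow, map_natCast, map_natCast, map_add, map_mul, map_pow, map_natCast, map_natCast]
  obtain ⟨b₁, w₁, h₁⟩ := hb (c • m)
  obtain ⟨b₂, w₂, h₂⟩ := hb m
  refine ⟨b₁ - algebraMap (Ainf (p := p) F) (AinfRam D) (zpToAinf c) * b₂,
    (p : BdRPlusTop F p) ^ N * (w₁ - BdRPlusTop.ofAinf F p (zpToAinf c) * w₂), ?_⟩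
  have key : (d : BdRPlusTop F p) * (φ (a • m) - BdRPlusTop.ofAinf F p (zpToAinf a) * φ m) =
      (p : BdRPlusTop F p) ^ N * ((d : BdRPlusTop F p) * φ (c • m) -
        BdRPlusTop.ofAinf F p (zpToAinf c) * ((d : BdRPlusTop F p) * φ m)) := by
    rw [hsmul, map_add, map_nsmul, map_nsmul, hι, nsmul_eq_mul, nsmul_eq_mul, Nat.cast_pow]
    ring
  rw [key, h₁, h₂, of_toBdR_natCast_pow_mul, map_sub, map_sub, of_toBdR_algebraMap_mul]
  ring

end AinfRam

/-! ## §3 Series with `𝒪_D`-controlled denominators at points from `A_inf(𝒪)` -/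

namespace BdRPlusTop

variable {F : Type} [Field F] [ValuativeRel F] [TopologicalSpace F] [IsNonarchimedeanLocalField F] [CharZero F]
  {p : ℕ} [Fact p.Prime] [Fact (¬ IsUnit (p : integerC F))] [IsAdicComplete (Ideal.span {(p : integerC F)}) (integerC F)]
  {hp : valuation F p < 1} (D : EisensteinRoot F p hp) {hθ : Function.Surjective (fontaineTheta (integerC F) p)}

/-- **Uniform boundedness modulo `Fil^k` over the ramified base**: if `d·fₙ ∈ ι_𝒪(A_inf(𝒪))` (read in `B_dR⁺`) for `n < k` and
`x = ι_𝒪(a) ∈ Fil¹` (`a ∈ A_inf(𝒪)`), then `d·f(x) = ι_𝒪(b) + ξ_dR^k·w` for some `b ∈ A_inf(𝒪)`, `w ∈ B_dR⁺` — namely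
`b = Σ_{n<k} (d fₙ) aⁿ`. [cite: FontaineAsterisque223III, Exp. II §1.5.3] -/
theorem exists_eq_toBdR_add_of_coeff (f : PowerSeries (FieldCoeff hp hθ)) (hf : PowerSeries.constantCoeff f = 0) (k : ℕ) (d : ℤ)
    (hd : ∀ n, n < k → ∃ b : AinfRam D,
      algebraMap (FieldCoeff hp hθ) (BdRPlusTop F p) ((d : FieldCoeff hp hθ) * PowerSeries.coeff n f) = of F p (AinfRam.toBdR D hθ b))
    {a : AinfRam D} (ha : of F p (AinfRam.toBdR D hθ a) ∈ (filOne F p).toIdeal) :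
    ∃ (b : AinfRam D) (w : BdRPlusTop F p),
      (d : BdRPlusTop F p) * (evalPt₁ (filOne F p) f hf ⟨of F p (AinfRam.toBdR D hθ a), ha⟩ : BdRPlusTop F p) =
        of F p (AinfRam.toBdR D hθ b) + of F p xiBdR ^ k * w := by
  choose! b hb using hd
  set P : PowerSeries (FieldCoeff hp hθ) :=
    ∑ n ∈ Finset.range k, PowerSeries.C ((d : FieldCoeff hp hθ) * PowerSeries.coeff n f) * PowerSeries.X ^ n with hP
  have hdvd : (PowerSeries.X : PowerSeries (FieldCoeff hp hθ)) ^ k ∣ PowerSeries.C (d : FieldCoeff hp hθ) * f - P := by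
    rw [PowerSeries.X_pow_dvd_iff]
    intro m hm
    rw [map_sub, PowerSeries.coeff_C_mul, hP, map_sum]
    simp_rw [PowerSeries.coeff_C_mul_X_pow]
    rw [Finset.sum_ite_eq, if_pos (Finset.mem_range.2 hm), sub_self]
  obtain ⟨h, hh⟩ := hdvd
  set x : (filOne F p).toIdeal := ⟨of F p (AinfRam.toBdR D hθ a), ha⟩ with hxdef
  have hx := (filOne F p).hasEval fun _ : Unit => x
  have hX : aeval hx (PowerSeries.X : PowerSeries (FieldCoeff hp hθ)) = of F p (AinfRam.toBdR D hθ a) := aeval_X' hx ()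
  have hC : ∀ c : FieldCoeff hp hθ, aeval hx (PowerSeries.C c) = algebraMap (FieldCoeff hp hθ) (BdRPlusTop F p) c := fun c => by
    rw [PowerSeries.C_eq_algebraMap]
    exact (aeval hx).commutes c
  have hdec : PowerSeries.C (d : FieldCoeff hp hθ) * f = P + PowerSeries.X ^ k * h := by rw [← hh]; ring
  have key : (d : BdRPlusTop F p) * aeval hx f = aeval hx P + of F p (AinfRam.toBdR D hθ a) ^ k * aeval hx h := by
    have h2 := congrArg (aeval hx) hdec
    rw [map_mul, map_add, map_mul, map_pow, hX, hC, map_intCast] at h2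
    exact h2
  have hPval : aeval hx P = of F p (AinfRam.toBdR D hθ (∑ n ∈ Finset.range k, b n * a ^ n)) := by
    rw [hP, map_sum, map_sum, map_sum]
    refine Finset.sum_congr rfl fun n hn => ?_
    rw [map_mul, map_pow, hX, hC, hb n (Finset.mem_range.1 hn), map_mul, map_pow, map_mul, map_pow]
  obtain ⟨c, hc⟩ := Ideal.mem_span_singleton'.1 (show of F p (AinfRam.toBdR D hθ a) ∈ Ideal.span {of F p xiBdR} from ha)
  refine ⟨∑ n ∈ Finset.range k, b n * a ^ n, c ^ k * aeval hx h, ?_⟩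
  change (d : BdRPlusTop F p) * aeval hx f = _
  rw [key, hPval, ← hc]
  ring

end BdRPlusTop

/-! ## §4 Denominators of `log_W` over `𝒪_D` and boundedness of `∫_t ω` -/

namespace AinfRamTop

variable {F : Type} [Field F] [ValuativeRel F] [TopologicalSpace F] [IsNonarchimedeanLocalField F] [CharZero F]
  {p : ℕ} [Fact p.Prime] [Fact (¬ IsUnit (p : integerC F))] [IsAdicComplete (Ideal.span {(p : integerC F)}) (integerC F)]
  {hp : valuation F p < 1} {D : EisensteinRoot F p hp} {hθ : Function.Surjective (fontaineTheta (integerC F) p)}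
  (W : WeierstrassCurve (EisensteinRoot.CoeffDisc D))

/-- **`(n+1)·coeff (n+1) log_W = ωₙ ∈ 𝒪_D`** for `W` over `𝒪_D` (`d log_W = ω = formalInvDiff`, an integral series).
[cite: SilvermanAEC2009, IV.5.5] -/
theorem succ_mul_coeff_succ_logSeries (n : ℕ) :
    ((n : FieldCoeff hp hθ) + 1) * PowerSeries.coeff (n + 1) (logSeries hθ W) =
      FieldCoeff.of hp hθ (EisensteinRoot.CoeffDisc.toF D (PowerSeries.coeff n W.formalInvDiff)) := by
  have h := congrArg (PowerSeries.coeff n) (W.map (EisensteinRoot.CoeffDisc.toF D)).derivative_formalLog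
  rw [PowerSeries.coeff_derivative, ← WeierstrassCurve.formalInvDiff_eq_formalOmega, ← WeierstrassCurve.map_formalInvDiff,
    PowerSeries.coeff_map] at h
  rw [logSeries, PowerSeries.coeff_map, mul_comm, ← map_natCast (FieldCoeff.of hp hθ).toRingHom n,
    ← map_one (FieldCoeff.of hp hθ).toRingHom, ← map_add, ← map_mul, h]
  rfl

/-- From `(n+1)·f_{n+1} ∈ 𝒪_D` to `k!·fₙ ∈ 𝒪_D` for `n ≤ k`. [folklore] -/
private theorem exists_factorial_mul_coeff_eq (f : PowerSeries (FieldCoeff hp hθ)) (hf0 : PowerSeries.constantCoeff f = 0)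
    (c : ℕ → EisensteinRoot.CoeffDisc D)
    (hf : ∀ n : ℕ, ((n : FieldCoeff hp hθ) + 1) * PowerSeries.coeff (n + 1) f =
      FieldCoeff.of hp hθ (EisensteinRoot.CoeffDisc.toF D (c n))) (k n : ℕ) (hn : n < k + 1) :
    ∃ z : EisensteinRoot.CoeffDisc D, ((k.factorial : ℤ) : FieldCoeff hp hθ) * PowerSeries.coeff n f =
      FieldCoeff.of hp hθ (EisensteinRoot.CoeffDisc.toF D z) := by
  rcases n with _ | m
  · exact ⟨0, by rw [PowerSeries.coeff_zero_eq_constantCoeff, hf0, mul_zero, map_zero, map_zero]⟩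
  · have hdvd : m + 1 ∣ k.factorial := Nat.dvd_factorial (Nat.succ_pos m) (by omega)
    obtain ⟨q, hq⟩ := hdvd
    refine ⟨(q : EisensteinRoot.CoeffDisc D) * c m, ?_⟩
    rw [hq, Nat.cast_mul, Int.cast_mul, Int.cast_natCast, Int.cast_natCast, map_mul, map_natCast, map_mul, map_natCast, ← hf m,
      Nat.cast_succ]
    ring

/-- `k!·logₙ ∈ ι_𝒪(A_inf(𝒪))` read in `B_dR⁺` (`n ≤ k`): the coefficient `(k!/n)·ω_{n-1} ∈ 𝒪_D` maps through
`𝒪_D → A_inf(𝒪) → B_dR⁺`, which agrees with `𝒪_D → F → B_dR⁺` (`AinfRam.toBdR_coeffHom`). [cite: FontaineAsterisque223III, Exp. II §1.5.3] -/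
theorem exists_algebraMap_factorial_mul_coeff_logSeries_eq (k n : ℕ) (hn : n < k + 1) :
    ∃ b : AinfRam D, algebraMap (FieldCoeff hp hθ) (BdRPlusTop F p)
        (((k.factorial : ℤ) : FieldCoeff hp hθ) * PowerSeries.coeff n (logSeries hθ W)) =
      BdRPlusTop.of F p (AinfRam.toBdR D hθ b) := by
  obtain ⟨z, hz⟩ := exists_factorial_mul_coeff_eq (logSeries hθ W) (constantCoeff_logSeries W) _
    (succ_mul_coeff_succ_logSeries W) k n hn
  refine ⟨AinfRam.coeffHom D ((EisensteinRoot.CoeffDisc.of D).symm z), ?_⟩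
  rw [hz, FieldCoeff.algebraMap_of, AinfRam.toBdR_coeffHom]
  rfl

/-- **`k!·∫_t ω ∈ ι_𝒪(A_inf(𝒪)) + Fil^k B_dR⁺`**, uniformly in the `[p]`-compatible sequence `t` (`W` over the ramified base
`𝒪_D`). [cite: FontaineAsterisque223III, Exp. II §1.5.3] [cite: Colmez1992PeriodesAbeliennes, §2] -/
theorem omegaPeriod_bounded (k : ℕ) {t : ℕ → (maxNilIdealC F).toIdeal} (ht0 : (t 0 : CBall F) = 0)
    (htp : ∀ n, mulPC W (t (n + 1)) = t n) :
    ∃ (b : AinfRam D) (w : BdRPlusTop F p),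
      ((k.factorial : ℤ) : BdRPlusTop F p) * omegaPeriod W hθ t ht0 htp =
        BdRPlusTop.of F p (AinfRam.toBdR D hθ b) + BdRPlusTop.of F p xiBdR ^ k * w :=
  BdRPlusTop.exists_eq_toBdR_add_of_coeff D (logSeries hθ W) (constantCoeff_logSeries W) k _
    (fun n hn => exists_algebraMap_factorial_mul_coeff_logSeries_eq W k n (by omega))
    (toBdR_torsionLift_mem_filOne W ht0 htp)

end AinfRamTop

end Literature.NumberTheory.PAdicHodge

end
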